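import Summits.BirchSwinnertonDyer.BirchSwinnertonDyer.Theorems.QuadraticBranchSignedControlNoFiniteSubmoduleGlue
import Summits.BirchSwinnertonDyer.BirchSwinnertonDyer.Theorems.QuadraticBranchSignedControlNoFiniteSubmodulePlusOfEta
import Summits.BirchSwinnertonDyer.BirchSwinnertonDyer.Theorems.QuadraticBranchSignedControlNoFiniteSubmoduleMinusOfEta
import Literature.NumberTheory.EllipticCurves.KitajimaOtsuki2018.EtaSelmerNoFiniteSubmodule
import HarnessLib

/-!
# Route `QuadraticBranchSignedControl` (rung K8, cell `bsd-potss`): the crux (R2±)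
# `NoFiniteSubmoduleSigned` (stmt-BirchSwinnertonDyer-19117) and BOTH its sign items
# `NoFiniteSubmodulePlus` (19222) / `NoFiniteSubmoduleMinus` (19233) from ONE NAMED LITERATURE FACT:
# `KitajimaOtsuki2018.mainThm13_etaSignedSelmerDual_noFiniteSubmodule` (Kitajima–Otsuki 2018 Main
# Thm. 1.3, `F = ℚ`, both signs, on the `η`-components of `X^±(E/ℚ(μ_{p^∞}))`) — NO other hypothesis

HONEST FRAMING (cell `bsd-potss`, run/shared/lean/pub/bsd-potss/; FULL-BSD rank ≤ 1 programme,
tranche 1b): CONDITIONAL RESULTS on exactly ONE named Literature fact (a published theorem, unproved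
in the tree; `conditional-result`), with NO reading frame, no side hypothesis, no definition, no
`sorry`, axioms standard. The fact (cell bsd-cm, seat `bsd-cm-k8i-ty`, landed 2026-08-26T03:16Z on
the Literature home `Kobayashi2003/CyclotomicTowerSignedSelmer.lean` = the PROMOTION COPY, identical
bodies, of cc-typer-6's `Γ_ℚ`-internal tower vocabulary) is, binder for binder, ctrl's `hKO` frame
(sign `+`, `QuadraticBranchEvenReadingsOfEta`) and x1b's `hKO` frame (sign `−`,
`SignedTwistOddBranchReadings`) — read on the Literature-homed COPY of the hypothesis structure
`EtaSignedSelmerDualData`. The only work here is the BRIDGE between the two copies of that structure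
(two `structure` declarations with identical field types are distinct types; a Summits-side datum is
repackaged field by field as a Literature-side datum with the SAME module — every field transfers by
definitional unfolding of the copied vocabulary), after which this seat's landed frame theorems
`noFiniteSubmodulePlus_of_kitajimaOtsuki13PlusEta` (p418318) / `noFiniteSubmoduleMinus_of_…MinusEta`
(p418319) and the glue `noFiniteSubmoduleSigned_of_signs` (p418098) apply verbatim. The items are
NOT closed by this file (the fact is a hypothesis); what it records is that the K8 crux (R2±) and its
two sign items ARE Kitajima–Otsuki's printed theorem (flags `KO18-F=Q-Rem14(5)`, `KO18-eta-summand`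
travel with the fact; the latter — "an `η`-part is a direct summand of the printed whole" — is
discharged in the kernel on the Summits side by this seat's
`EtaSignedSelmerDualData.forall_finite_eq_bot_of_tower`, p418977). BSD is not proved by any of this.

References: [KitajimaOtsuki2018] Main Thm. 1.3 (= Thm. 4.8) with Def. 2.1, §2 p. 6, Remark 1.4 (5)
(arXiv:1607.03612 pp. 3, 4, 6); [Kobayashi2003] §2 p. 4, Def. 2.1 and Thm. 2.2 (p. 5), §4 p. 8.
-/

set_option autoImplicit false
set_option linter.dupNamespace false

noncomputable section

open scoped Classical

namespace Summit.BirchSwinnertonDyer.BirchSwinnertonDyer.Theorems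

open WeierstrassCurve Field Literature.NumberTheory.EllipticCurves
  Literature.NumberTheory.GaloisRepresentations ZpExtension
  Summit.BirchSwinnertonDyer.BirchSwinnertonDyer.Theses.QuadraticBranchSignedControl

/-- **(R2⁺) `NoFiniteSubmodulePlus` (item stmt-BirchSwinnertonDyer-19222) from the NAMED fact
`KitajimaOtsuki2018.mainThm13_etaSignedSelmerDual_noFiniteSubmodule` alone.** The fact at `ε = 1`,
`p ≥ 5`, read back onto cell bsd-potss's (Summits-side) copy of `EtaSignedSelmerDualData` by
repackaging the datum (same module `D.X`, fields transferred definitionally), is ctrl's `hKO` frame;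
then `noFiniteSubmodulePlus_of_kitajimaOtsuki13PlusEta`. CONDITIONAL on the named fact; closes
nothing by itself. [cite: KitajimaOtsuki2018, Main Thm. 1.3 (= Thm. 4.8) with Def. 2.1 (arXiv:1607.03612 pp. 3, 6)]
[cite: Kobayashi2003, Def. 2.1 (p. 5), §4 p. 8 (the η-component)] -/
theorem noFiniteSubmodulePlus_of_mainThm13Eta
    (hKO : KitajimaOtsuki2018.mainThm13_etaSignedSelmerDual_noFiniteSubmodule) :
    NoFiniteSubmodulePlus :=
  noFiniteSubmodulePlus_of_kitajimaOtsuki13PlusEta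
    fun p _ _ K₀ _ _ _ _ ηq hηK V _ _ hp2 hgood hap κ γ hκ hγ hγK D hfin htor M hM ↦
      hKO p K₀ ηq hηK V hp2 hgood hap κ γ hκ hγ hγK 1
        { X := D.X
          addCommGroup := D.addCommGroup
          module := D.module
          conj_mem := D.conj_mem
          toDual := D.toDual
          bijective := D.bijective
          toDual_T_smul := D.toDual_T_smul
          toDual_C_smul := D.toDual_C_smul }
        hfin htor M hM

/-- **(R2⁻) `NoFiniteSubmoduleMinus` (item stmt-BirchSwinnertonDyer-19233) from the NAMED fact
`KitajimaOtsuki2018.mainThm13_etaSignedSelmerDual_noFiniteSubmodule` alone** (`ε = −1`: Kobayashi's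
§2 minus object WITH the `m = −1` clause = Kitajima–Otsuki's Def. 2.1 for `F = ℚ`), via the same
repackaging and x1b's frame theorem `noFiniteSubmoduleMinus_of_kitajimaOtsuki13MinusEta`. CONDITIONAL
on the named fact; closes nothing by itself.
[cite: KitajimaOtsuki2018, Main Thm. 1.3 (= Thm. 4.8) with Def. 2.1 (arXiv:1607.03612 pp. 3, 6)]
[cite: Kobayashi2003, §2 p. 4 (the m = −1 clause), Def. 2.1 (p. 5), §4 p. 8] -/
theorem noFiniteSubmoduleMinus_of_mainThm13Eta
    (hKO : KitajimaOtsuki2018.mainThm13_etaSignedSelmerDual_noFiniteSubmodule) :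
    NoFiniteSubmoduleMinus :=
  noFiniteSubmoduleMinus_of_kitajimaOtsuki13MinusEta
    fun p _ _ K₀ _ _ _ _ η hηK V _ _ hp2 hgood hap κ γ hκ hγ hγK D hfin htor M hM ↦
      hKO p K₀ η hηK V hp2 hgood hap κ γ hκ hγ hγK (-1)
        { X := D.X
          addCommGroup := D.addCommGroup
          module := D.module
          conj_mem := D.conj_mem
          toDual := D.toDual
          bijective := D.bijective
          toDual_T_smul := D.toDual_T_smul
          toDual_C_smul := D.toDual_C_smul }
        hfin htor M hM

/-- **(R2±) the K8 crux `NoFiniteSubmoduleSigned` (item stmt-BirchSwinnertonDyer-19117) from the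
NAMED fact `KitajimaOtsuki2018.mainThm13_etaSignedSelmerDual_noFiniteSubmodule` alone**: both sign
items (above) and the glue `noFiniteSubmoduleSigned_of_signs`. CONDITIONAL on the named fact — the
crux is Kitajima–Otsuki 2018 Main Thm. 1.3 (`F = ℚ`) and nothing more; closes nothing by itself.
[cite: KitajimaOtsuki2018, Main Thm. 1.3 (= Thm. 4.8) with Def. 2.1 (arXiv:1607.03612 pp. 3, 6)]
[cite: Kobayashi2003, Def. 2.1 (p. 5), §4 p. 8] -/
theorem noFiniteSubmoduleSigned_of_mainThm13Eta
    (hKO : KitajimaOtsuki2018.mainThm13_etaSignedSelmerDual_noFiniteSubmodule) :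
    NoFiniteSubmoduleSigned :=
  noFiniteSubmoduleSigned_of_signs (noFiniteSubmodulePlus_of_mainThm13Eta hKO)
    (noFiniteSubmoduleMinus_of_mainThm13Eta hKO)

end Summit.BirchSwinnertonDyer.BirchSwinnertonDyer.Theorems

end
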